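import Summits.QuantumFields.YangMills.Theorems.BalabanUVNodesN11NoExpansionGeneralStepGraph
import Literature.MathematicalPhysics.QuantumFieldTheory.Balaban1983to89.Node00.Record13SepCoPHChi
import Literature.MathematicalPhysics.QuantumFieldTheory.Balaban1983to89.Node00.Record13ResidualsRChi
import Summits.QuantumFields.YangMills.Theorems.BalabanUVNodesN11NoExpansionAtRecord13CoPChi
import Summits.QuantumFields.YangMills.Theorems.BalabanUVNodesN11NoExpansionDiagonalCoPHChi
import Summits.QuantumFields.YangMills.Theorems.BalabanUVNodesN11BackgroundScaleLocalChi
import Summits.QuantumFields.YangMills.Theorems.BalabanUVNodesN11NoExpansionOldFactorsChi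
import Summits.QuantumFields.YangMills.Theorems.BalabanUVNodesN11NoExpansionGeneralStepCoPHOldBranchChi

/-!
# χ-GENERIC RE-ISSUE (WORK ORDER RC-1 «RE-CENTRE THE RECORD», director-ym №462 (B) ∕ №467 (D)) of `BalabanUVNodesN11NoExpansionGeneralStepGraph`

Cell `pub-ymgap` (HUMAN RULING D-0062, Track A), seat `pub-ymgap-dag-n11-d` (N11 [B14] s2; N11-σ campaign, `N11-G44-RC1-REACH-CENSUS.md`).  The CENTRE-TYPED
declarations of `BalabanUVNodesN11NoExpansionGeneralStepGraph` (those whose statement reads the (2.9) cut-off centre through `gOfRecord₁₃ ∕ EOfRecord₁₃ ∕ Provisos₁₃… ∕ T∕SLaw₁₃… ∕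
UbgOfRecord₁₃… ∕ WtOfRecord₁₃… ∕ datum∕tower∕coreOfRecord₁₃…`) RE-ISSUED VERBATIM in the β-slot `χ : ChiSlot F N` over [Ax-3b]∕[Ax-3c]∕[Ax-3d]'s χ-generic carriers
(`Node00/Record13Chi` ∕ `Record13CoPHChi` ∕ `Record13SepCoPHChi`): σ = (binder `(χ : ChiSlot F N)` after `θ`; Node00 defs `X ↦ XChi … χ`; Node00 rows `Y ↦ Y_chi`;
this lane's sibling modules `…Chi` for Summits-side dependencies); SAME short names in the sibling namespace `…BalabanUVNodesN11NoExpansionGeneralStepGraphChi` (consumers switch by namespace);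
the 0 centre-FREE declarations of the original are NOT copied — they are reused BY NAME (`open … (…)` below).  At `χ := chiβOfRecord₁₃ θ` every statement here is
DEFINITIONALLY the landed one ([Ax-3b]'s `rfl` receipts); at `χ := chiβOfRecord₁₃Ax θ` it is what the Ax-record's N11 machine reads.  Nothing of record edited (body-freeze №460 (2)).

HONEST FRAMING.  Count-neutral kernel re-elaboration of landed N11 bookkeeping∕estimates in a parameter; every HYPOTHESIS of the original stays a hypothesis; nothing of
Bałaban asserted beyond what the original file proves; N11 NOT discharged; K-items untouched; counts unmoved.  One finite `𝕋⁴_{L^K}` programme at fixed `ε = L^{−K}` —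
NOT ℝ⁴, NOT OS, NOT a mass gap, NOT Clay.  No `sorry`∕`instance`∕`notation`.  Sources: as the original module, plus [I] = [Balaban1987RG1] (2.9) p.266 (the cut-off's centre).
-/

noncomputable section

open MeasureTheory
open scoped BigOperators Matrix.Norms.L2Operator

namespace Summit.QuantumFields.YangMills.Theorems.BalabanUVNodesN11NoExpansionGeneralStepGraphChi

open Literature.MathematicalPhysics.QuantumFieldTheory.Balaban1983to89 T4Continuum Node00 Node00.Tk DagBinding
open B15DeterminingSets
open BalabanUVNodesN11NoExpansionZetaSpecSucc (noExpIntegrandAt_eq_zetaFactor_mul)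
open BalabanUVNodesN11TkFullBondTransportGraph (TkOfRecord_succ_ae_eq_sum_transportOfRecord_of_Omega_empty_of_graph transportOfRecord_finset_sum_ae_of_graph)
open BalabanUVNodesN11NoExpansionOldFactorsChi (oldFactors_agree_of_Omega_empty)
open BalabanUVNodesN11TkBranchWeightCongr (sect2Slot_congr_of_weights tkWeightsOfRecordP_ζ_congr tkWeightsOfRecordP_w_congr)
open BalabanUVNodesN11NoExpansionDiagonalAtZ (tkWeightsOfRecordP_ζ_apply tkWeightsOfRecordP_w_empty tkWeightsOfRecordP_ζ_local)
open BalabanUVNodesN11NoExpansionDiagonalCoPHChi (WtOfRecord₁₃H_eq_tkWeightsOfRecordP)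
open BalabanUVNodesN11NoExpansionGeneralStepCoPH (tkWeightsOfRecordP_w_local_of_quad_local)
open BalabanUVNodesN11NoExpansionGeneralStepCoPHOldBranchChi (newIntegrand_eq_of_pinChi measurable_chiSeqOfRecord_init)

variable {F : T4Family} {N : ℕ} [NeZero N]

/-! ## §1  R3′ — any weight family, generic `θ : Stage13Params` -/

section Positive

variable (θ : Stage13Params F N) (χ : ChiSlot F N) (p : B12.RunParams)

/-- **★★ THE (S1ᵀ)₁₃ IDENTITY AT A NO-EXPANSION NEW SEQUENCE AFTER AN ARBITRARY HISTORY, UNDER OLD-FACTOR AGREEMENT AND THE GENERATION-`k` ζ-SPEC WITH THE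
OLD FRONT FACTOR — ANY WEIGHT FAMILY.**  Let `s′` have `Ω_{k+1}(s′) = ∅` (`k < K`; nothing asked of `Ω_1, …, Ω_k`), `W` any 𝐓-weight family, `(t, E_k, U_k)` a
§2 witness of `ρ_k`'s slot at `init s′` (identity a.e. ON THE `χ_k(init s′)`-SUPPORT — `hid`), and `(t′, E_{k+1}, U_{k+1})` the proposed witness at `s′`.  Suppose
(ii) OLD-FACTOR AGREEMENT ((3.24)): for every old branch `S`, `𝐓_k(init s′,S)[e^{A_{k+1}(s′)}]_S (U, V′) = κ·𝐓_k(init s′,S)[e^{A_k(init s′)}]_S (U)`;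
(iii) THE GENERATION-`k` SPEC WITH `χ_k` on the averaging graph: `ζ_k(T)(U,Ū)·w_k(∅,∅,∅)(U,Ū) = c·χ_k(init s′)(U)·w_k(s′)(U,Ū)`, `c·κ = 1`; the INTEGRABILITY ALONG THE AVERAGING GRAPH of the new integrand per old branch
(p560499's joint-measurability binder `hm` DROPPED — the joint law is carried by the graph, `…N11TkFullBondTransportGraph`).  Then `slotT_{k+1}(s′)(V′) = 𝐓_{k+1}(s′)e^{A_{k+1}(s′)}(V′)` for `dV′`-a.e. `V′` on the
`χ_{k+1}(s′)`-support.  Proof: def-T's slot is `T_k[w_k(s′)·χ_k·slot_k(init s′)]` =ᵐ `T_k[w_k(s′)·χ_k·Σ_S 𝐓_k(init s′,S)e^{A_k}_S]` (`hid` on the support,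
both sides `0` off it; `transportK_congr_ae_family`); 11a's slot is =ᵐ `Σ_S T_k[ζ_k w_k·𝐓_k(init s′,S)e^{A_{k+1}}_S]` (g3) `= T_k[Σ_S …]`; the two integrands AGREE
ON THE GRAPH `V′ = Ū` by (ii)–(iii); g3's `transportK_congr_ae_of_fibre` closes.
[cite: Balaban1988Convergent, Theorem p.245, (3.24)–(3.25) p.270, (2.18) p.257, (2.20)–(2.23) p.258, (3.1) p.264, (3.16) p.268] -/
theorem slotsT_succ_ae_eq_sect2Slot_of_zetaSpecChiAt_of_graph {k : ℕ} (hk : k < p.K)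
    (s : SeqOfRecord F θ.ν θ.τ9.M (gOfRecord₁₃Chi F N θ χ p) p.K (k + 1)) (hΩ : s.Ω (k + 1) = ∅) (W : TkWeights F N (FluctV N) p.K)
    (Rz : Sect2.Residual (F.P p.K) (MatA N))
    (t : Sect2.TermValues (F.P p.K) (MatA N) (FluctV N) θ.τ9.M) (Ek : ℝ) (U : BgMap F N p.K)
    (hid : ∀ᵐ U₀ ∂fieldMeasure (F.P p.K) k (SU N),
      chiSeqOfRecord F N θ.ν θ.τ9.M (gOfRecord₁₃Chi F N θ χ p) p.K k s.init U₀ ≠ 0 →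
        slotsOfRecord F N θ.ν θ.τ9 (EOfRecord₁₃Chi F N θ χ) (wOfRecord₉ F N θ.toStage9Params) θ.ppSel p
            (gOfRecord₁₃Chi F N θ χ p) k s.init U₀ =
          sect2Slot F N (FluctV N) p.K (settingOfRecord₁₃Chi F N θ χ p) Rz W s.init t Ek U U₀)
    (Rz' : Sect2.Residual (F.P p.K) (MatA N))
    (t' : Sect2.TermValues (F.P p.K) (MatA N) (FluctV N) θ.τ9.M) (Ek' : ℝ) (U' : BgMap F N p.K)
    {κ c : ℝ} (hcκ : c * κ = 1)
    (hbranch : ∀ S ∈ admSOfRecord F θ.ν θ.τ9.M (gOfRecord₁₃Chi F N θ χ p) p.K k s.init,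
      ∀ (V' : GaugeField (F.P p.K) (k + 1) (SU N)) (U₀ : GaugeField (F.P p.K) k (SU N)),
        tkBranchOfRecord F N (FluctV N) θ.ν θ.τ9.M _ p.K W s.init S k
            (fun ω => sect2Operand F N (FluctV N) p.K (settingOfRecord₁₃Chi F N θ χ p) Rz' s t' Ek' U' (S, fun j => (ω j).2) (fun j => (ω j).1))
            (pairCfgAt (V := FluctV N) k V' U₀) =
          κ * tkBranchOfRecord F N (FluctV N) θ.ν θ.τ9.M _ p.K W s.init S k
            (fun ω => sect2Operand F N (FluctV N) p.K (settingOfRecord₁₃Chi F N θ χ p) Rz s.init t Ek U (S, fun j => (ω j).2) (fun j => (ω j).1))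
            (baseCfg k U₀))
    (hζχ : ∀ U₀ : GaugeField (F.P p.K) k (SU N),
      W.ζ k Set.univ (pairCfgAt (V := FluctV N) k ((avOfRecord F N p.K k).avg U₀) U₀) *
          W.w k ∅ ∅ ∅ (pairCfgAt (V := FluctV N) k ((avOfRecord F N p.K k).avg U₀) U₀) =
        c * (chiSeqOfRecord F N θ.ν θ.τ9.M (gOfRecord₁₃Chi F N θ χ p) p.K k s.init U₀ *
          wOfRecord₉ F N θ.toStage9Params p (gOfRecord₁₃Chi F N θ χ p) k s U₀ ((avOfRecord F N p.K k).avg U₀)))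
    (hI : ∀ S ∈ admSOfRecord F θ.ν θ.τ9.M (gOfRecord₁₃Chi F N θ χ p) p.K k s.init,
      Integrable (fun U₀ : GaugeField (F.P p.K) k (SU N) => noExpIntegrandAt F N (FluctV N) p.K k W
        (tkBranchOfRecord F N (FluctV N) θ.ν θ.τ9.M _ p.K W s.init S k
          (fun ω => sect2Operand F N (FluctV N) p.K (settingOfRecord₁₃Chi F N θ χ p) Rz' s t' Ek' U' (S, fun j => (ω j).2) (fun j => (ω j).1)))
        ((avOfRecord F N p.K k).avg U₀) U₀) (fieldMeasure (F.P p.K) k (SU N))) :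
    ∀ᵐ V' ∂fieldMeasure (F.P p.K) (k + 1) (SU N),
      chiSeqOfRecord F N θ.ν θ.τ9.M (gOfRecord₁₃Chi F N θ χ p) p.K (k + 1) s V' ≠ 0 →
        slotsTOfRecord F N θ.ν θ.τ9 (EOfRecord₁₃Chi F N θ χ) (wOfRecord₉ F N θ.toStage9Params) θ.ppSel p
            (gOfRecord₁₃Chi F N θ χ p) (k + 1) s V' =
          sect2Slot F N (FluctV N) p.K (settingOfRecord₁₃Chi F N θ χ p) Rz' W s t' Ek' U' V' := by
  classical
  -- abbreviations: the old branches of the old operand at the base configuration, and the new integrand per old branch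
  set B : (ℕ → Set (Site (F.P p.K) 0)) → GaugeField (F.P p.K) k (SU N) → ℝ := fun S U₀ =>
    tkBranchOfRecord F N (FluctV N) θ.ν θ.τ9.M _ p.K W s.init S k
      (fun ω => sect2Operand F N (FluctV N) p.K (settingOfRecord₁₃Chi F N θ χ p) Rz s.init t Ek U (S, fun j => (ω j).2) (fun j => (ω j).1))
      (baseCfg k U₀) with hB
  set G : (ℕ → Set (Site (F.P p.K) 0)) → GaugeField (F.P p.K) (k + 1) (SU N) → GaugeField (F.P p.K) k (SU N) → ℝ := fun S V' U₀ =>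
    noExpIntegrandAt F N (FluctV N) p.K k W
      (tkBranchOfRecord F N (FluctV N) θ.ν θ.τ9.M _ p.K W s.init S k
        (fun ω => sect2Operand F N (FluctV N) p.K (settingOfRecord₁₃Chi F N θ χ p) Rz' s t' Ek' U' (S, fun j => (ω j).2) (fun j => (ω j).1)))
      V' U₀ with hG
  set A := admSOfRecord F θ.ν θ.τ9.M (gOfRecord₁₃Chi F N θ χ p) p.K k s.init with hA
  set χk : GaugeField (F.P p.K) k (SU N) → ℝ := chiSeqOfRecord F N θ.ν θ.τ9.M (gOfRecord₁₃Chi F N θ χ p) p.K k s.init with hχk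
  -- (1) def-T's slot: a.e. the transport of `w(s′)·χ_k·Σ_S B_S` (SLaw's identity at `init s′` ON the support; both sides vanish off it)
  have hsect : ∀ U₀ : GaugeField (F.P p.K) k (SU N),
      sect2Slot F N (FluctV N) p.K (settingOfRecord₁₃Chi F N θ χ p) Rz W s.init t Ek U U₀ = ∑ S ∈ A, B S U₀ :=
    fun U₀ => TkOfRecord_apply F N (FluctV N) θ.ν θ.τ9.M _ p.K W k s.init _ U₀
  have h1 := transportK_congr_ae_family (avOfRecord_measurable F N p.K k) (avOfRecord_haarAC F N p.K k hk)
    (f := fun V' U₀ => wOfRecord₉ F N θ.toStage9Params p (gOfRecord₁₃Chi F N θ χ p) k s U₀ V' *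
      (χk U₀ * slotsOfRecord F N θ.ν θ.τ9 (EOfRecord₁₃Chi F N θ χ) (wOfRecord₉ F N θ.toStage9Params) θ.ppSel p (gOfRecord₁₃Chi F N θ χ p) k s.init U₀))
    (g := fun V' U₀ => wOfRecord₉ F N θ.toStage9Params p (gOfRecord₁₃Chi F N θ χ p) k s U₀ V' * (χk U₀ * ∑ S ∈ A, B S U₀))
    (hid.mono fun U₀ hU V' => by
      by_cases hne : χk U₀ = 0
      · simp only [hne, zero_mul, mul_zero]
      · rw [hU hne, hsect U₀])
  -- (2) 11a's slot: a.e. the sum over the old index of the transports of the new integrands (g3), = the transport of their sum (additivity)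
  have h2 := TkOfRecord_succ_ae_eq_sum_transportOfRecord_of_Omega_empty_of_graph θ.ν θ.τ9.M _ p.K W hk s hΩ
    (sect2Operand F N (FluctV N) p.K (settingOfRecord₁₃Chi F N θ χ p) Rz' s t' Ek' U') hI
  have hsum : ∀ᵐ V' ∂fieldMeasure (F.P p.K) (k + 1) (SU N),
      transportOfRecord F N p.K k (fun U₀ => ∑ S ∈ A, G S V' U₀) V' = ∑ S ∈ A, transportOfRecord F N p.K k (G S V') V' :=
    transportOfRecord_finset_sum_ae_of_graph F N p.K k hk A G (fun S hS => hI S hS)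
  -- (3) the two integrand families AGREE ON THE GRAPH `V′ = Ū`: old-factor agreement, the spec with `χ_k`, `c·κ = 1`
  have hfib : ∀ U₀ : GaugeField (F.P p.K) k (SU N),
      wOfRecord₉ F N θ.toStage9Params p (gOfRecord₁₃Chi F N θ χ p) k s U₀ ((avOfRecord F N p.K k).avg U₀) * (χk U₀ * ∑ S ∈ A, B S U₀) =
        ∑ S ∈ A, G S ((avOfRecord F N p.K k).avg U₀) U₀ := by
    intro U₀
    rw [← mul_assoc, Finset.mul_sum]
    refine Finset.sum_congr rfl fun S hS => ?_
    simp only [hG, hB]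
    rw [noExpIntegrandAt_eq_zetaFactor_mul, hζχ U₀, hbranch S hS]
    calc wOfRecord₉ F N θ.toStage9Params p (gOfRecord₁₃Chi F N θ χ p) k s U₀ ((avOfRecord F N p.K k).avg U₀) * χk U₀ *
          tkBranchOfRecord F N (FluctV N) θ.ν θ.τ9.M _ p.K W s.init S k
            (fun ω => sect2Operand F N (FluctV N) p.K (settingOfRecord₁₃Chi F N θ χ p) Rz s.init t Ek U (S, fun j => (ω j).2)
              (fun j => (ω j).1)) (baseCfg k U₀)
        = (c * κ) * (wOfRecord₉ F N θ.toStage9Params p (gOfRecord₁₃Chi F N θ χ p) k s U₀ ((avOfRecord F N p.K k).avg U₀) * χk U₀ *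
          tkBranchOfRecord F N (FluctV N) θ.ν θ.τ9.M _ p.K W s.init S k
            (fun ω => sect2Operand F N (FluctV N) p.K (settingOfRecord₁₃Chi F N θ χ p) Rz s.init t Ek U (S, fun j => (ω j).2)
              (fun j => (ω j).1)) (baseCfg k U₀)) := by rw [hcκ, one_mul]
      _ = c * (χk U₀ * wOfRecord₉ F N θ.toStage9Params p (gOfRecord₁₃Chi F N θ χ p) k s U₀ ((avOfRecord F N p.K k).avg U₀)) *
          (κ * tkBranchOfRecord F N (FluctV N) θ.ν θ.τ9.M _ p.K W s.init S k
            (fun ω => sect2Operand F N (FluctV N) p.K (settingOfRecord₁₃Chi F N θ χ p) Rz s.init t Ek U (S, fun j => (ω j).2)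
              (fun j => (ω j).1)) (baseCfg k U₀)) := by ring
  have h3 := transportK_congr_ae_of_fibre (avOfRecord_measurable F N p.K k) (avOfRecord_haarAC F N p.K k hk)
    (f := fun V' U₀ => wOfRecord₉ F N θ.toStage9Params p (gOfRecord₁₃Chi F N θ χ p) k s U₀ V' * (χk U₀ * ∑ S ∈ A, B S U₀))
    (g := fun V' U₀ => ∑ S ∈ A, G S V' U₀) hfib
  -- (4) assemble
  filter_upwards [h1, h2, h3, hsum] with V' e1 e2 e3 e4 _
  rw [slotsTOfRecord_succ_apply]
  show T4AveragingDisintegration.transportK (avOfRecord F N p.K k).avg _ V' = _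
  rw [e1, e3]
  show transportOfRecord F N p.K k (fun U₀ => ∑ S ∈ A, G S V' U₀) V' = _
  rw [e4]
  exact e2.symm

/-- **… HENCE THE DICHOTOMY CLAUSE AT `s′` ONE LEVEL UP** (identity branch), under the same hypotheses. [cite: Balaban1988Convergent, (2.17)–(2.18) p.257, (3.25) p.270] -/
theorem hasSect2FormAtZ_clause_succ_of_zetaSpecChiAt_of_graph {k : ℕ} (hk : k < p.K)
    (s : SeqOfRecord F θ.ν θ.τ9.M (gOfRecord₁₃Chi F N θ χ p) p.K (k + 1)) (hΩ : s.Ω (k + 1) = ∅) (W : TkWeights F N (FluctV N) p.K)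
    (Rz : Sect2.Residual (F.P p.K) (MatA N))
    (t : Sect2.TermValues (F.P p.K) (MatA N) (FluctV N) θ.τ9.M) (Ek : ℝ) (U : BgMap F N p.K)
    (hid : ∀ᵐ U₀ ∂fieldMeasure (F.P p.K) k (SU N),
      chiSeqOfRecord F N θ.ν θ.τ9.M (gOfRecord₁₃Chi F N θ χ p) p.K k s.init U₀ ≠ 0 →
        slotsOfRecord F N θ.ν θ.τ9 (EOfRecord₁₃Chi F N θ χ) (wOfRecord₉ F N θ.toStage9Params) θ.ppSel p
            (gOfRecord₁₃Chi F N θ χ p) k s.init U₀ =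
          sect2Slot F N (FluctV N) p.K (settingOfRecord₁₃Chi F N θ χ p) Rz W s.init t Ek U U₀)
    (Rz' : Sect2.Residual (F.P p.K) (MatA N))
    (t' : Sect2.TermValues (F.P p.K) (MatA N) (FluctV N) θ.τ9.M) (Ek' : ℝ) (U' : BgMap F N p.K)
    {κ c : ℝ} (hcκ : c * κ = 1)
    (hbranch : ∀ S ∈ admSOfRecord F θ.ν θ.τ9.M (gOfRecord₁₃Chi F N θ χ p) p.K k s.init,
      ∀ (V' : GaugeField (F.P p.K) (k + 1) (SU N)) (U₀ : GaugeField (F.P p.K) k (SU N)),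
        tkBranchOfRecord F N (FluctV N) θ.ν θ.τ9.M _ p.K W s.init S k
            (fun ω => sect2Operand F N (FluctV N) p.K (settingOfRecord₁₃Chi F N θ χ p) Rz' s t' Ek' U' (S, fun j => (ω j).2) (fun j => (ω j).1))
            (pairCfgAt (V := FluctV N) k V' U₀) =
          κ * tkBranchOfRecord F N (FluctV N) θ.ν θ.τ9.M _ p.K W s.init S k
            (fun ω => sect2Operand F N (FluctV N) p.K (settingOfRecord₁₃Chi F N θ χ p) Rz s.init t Ek U (S, fun j => (ω j).2) (fun j => (ω j).1))
            (baseCfg k U₀))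
    (hζχ : ∀ U₀ : GaugeField (F.P p.K) k (SU N),
      W.ζ k Set.univ (pairCfgAt (V := FluctV N) k ((avOfRecord F N p.K k).avg U₀) U₀) *
          W.w k ∅ ∅ ∅ (pairCfgAt (V := FluctV N) k ((avOfRecord F N p.K k).avg U₀) U₀) =
        c * (chiSeqOfRecord F N θ.ν θ.τ9.M (gOfRecord₁₃Chi F N θ χ p) p.K k s.init U₀ *
          wOfRecord₉ F N θ.toStage9Params p (gOfRecord₁₃Chi F N θ χ p) k s U₀ ((avOfRecord F N p.K k).avg U₀)))
    (hI : ∀ S ∈ admSOfRecord F θ.ν θ.τ9.M (gOfRecord₁₃Chi F N θ χ p) p.K k s.init,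
      Integrable (fun U₀ : GaugeField (F.P p.K) k (SU N) => noExpIntegrandAt F N (FluctV N) p.K k W
        (tkBranchOfRecord F N (FluctV N) θ.ν θ.τ9.M _ p.K W s.init S k
          (fun ω => sect2Operand F N (FluctV N) p.K (settingOfRecord₁₃Chi F N θ χ p) Rz' s t' Ek' U' (S, fun j => (ω j).2) (fun j => (ω j).1)))
        ((avOfRecord F N p.K k).avg U₀) U₀) (fieldMeasure (F.P p.K) k (SU N))) :
    slotsTOfRecord F N θ.ν θ.τ9 (EOfRecord₁₃Chi F N θ χ) (wOfRecord₉ F N θ.toStage9Params) θ.ppSel p (gOfRecord₁₃Chi F N θ χ p) (k + 1) s = 0 ∨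
      ∀ᵐ V' ∂fieldMeasure (F.P p.K) (k + 1) (SU N),
        chiSeqOfRecord F N θ.ν θ.τ9.M (gOfRecord₁₃Chi F N θ χ p) p.K (k + 1) s V' ≠ 0 →
          slotsTOfRecord F N θ.ν θ.τ9 (EOfRecord₁₃Chi F N θ χ) (wOfRecord₉ F N θ.toStage9Params) θ.ppSel p
              (gOfRecord₁₃Chi F N θ χ p) (k + 1) s V' =
            sect2Slot F N (FluctV N) p.K (settingOfRecord₁₃Chi F N θ χ p) Rz' W s t' Ek' U' V' :=
  Or.inr (slotsT_succ_ae_eq_sect2Slot_of_zetaSpecChiAt_of_graph θ χ p hk s hΩ W Rz t Ek U hid Rz' t' Ek' U' hcκ hbranch hζχ hI)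

/-- **★ CLAUSE-KEYED**: if the §2 DICHOTOMY (absent slot OR identity on the support) holds at `init s′` — the shape of `SLaw k`'s clause — then the 𝐓-image
dichotomy holds at `s′` (the `slot_k(init s′) = 0` branch gives `slotT_{k+1}(s′) = 0`: def-T's transport of the zero integrand).
[cite: Balaban1988Convergent, (2.17)–(2.18) p.257, (3.1) p.264, (3.25) p.270] -/
theorem clause_succ_of_zetaSpecChiAt_of_clause_of_graph {k : ℕ} (hk : k < p.K)
    (s : SeqOfRecord F θ.ν θ.τ9.M (gOfRecord₁₃Chi F N θ χ p) p.K (k + 1)) (hΩ : s.Ω (k + 1) = ∅) (W : TkWeights F N (FluctV N) p.K)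
    (Rz : Sect2.Residual (F.P p.K) (MatA N))
    (t : Sect2.TermValues (F.P p.K) (MatA N) (FluctV N) θ.τ9.M) (Ek : ℝ) (U : BgMap F N p.K)
    (hid : slotsOfRecord F N θ.ν θ.τ9 (EOfRecord₁₃Chi F N θ χ) (wOfRecord₉ F N θ.toStage9Params) θ.ppSel p (gOfRecord₁₃Chi F N θ χ p) k s.init = 0 ∨
      ∀ᵐ U₀ ∂fieldMeasure (F.P p.K) k (SU N),
        chiSeqOfRecord F N θ.ν θ.τ9.M (gOfRecord₁₃Chi F N θ χ p) p.K k s.init U₀ ≠ 0 →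
          slotsOfRecord F N θ.ν θ.τ9 (EOfRecord₁₃Chi F N θ χ) (wOfRecord₉ F N θ.toStage9Params) θ.ppSel p
              (gOfRecord₁₃Chi F N θ χ p) k s.init U₀ =
            sect2Slot F N (FluctV N) p.K (settingOfRecord₁₃Chi F N θ χ p) Rz W s.init t Ek U U₀)
    (Rz' : Sect2.Residual (F.P p.K) (MatA N))
    (t' : Sect2.TermValues (F.P p.K) (MatA N) (FluctV N) θ.τ9.M) (Ek' : ℝ) (U' : BgMap F N p.K)
    {κ c : ℝ} (hcκ : c * κ = 1)
    (hbranch : ∀ S ∈ admSOfRecord F θ.ν θ.τ9.M (gOfRecord₁₃Chi F N θ χ p) p.K k s.init,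
      ∀ (V' : GaugeField (F.P p.K) (k + 1) (SU N)) (U₀ : GaugeField (F.P p.K) k (SU N)),
        tkBranchOfRecord F N (FluctV N) θ.ν θ.τ9.M _ p.K W s.init S k
            (fun ω => sect2Operand F N (FluctV N) p.K (settingOfRecord₁₃Chi F N θ χ p) Rz' s t' Ek' U' (S, fun j => (ω j).2) (fun j => (ω j).1))
            (pairCfgAt (V := FluctV N) k V' U₀) =
          κ * tkBranchOfRecord F N (FluctV N) θ.ν θ.τ9.M _ p.K W s.init S k
            (fun ω => sect2Operand F N (FluctV N) p.K (settingOfRecord₁₃Chi F N θ χ p) Rz s.init t Ek U (S, fun j => (ω j).2) (fun j => (ω j).1))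
            (baseCfg k U₀))
    (hζχ : ∀ U₀ : GaugeField (F.P p.K) k (SU N),
      W.ζ k Set.univ (pairCfgAt (V := FluctV N) k ((avOfRecord F N p.K k).avg U₀) U₀) *
          W.w k ∅ ∅ ∅ (pairCfgAt (V := FluctV N) k ((avOfRecord F N p.K k).avg U₀) U₀) =
        c * (chiSeqOfRecord F N θ.ν θ.τ9.M (gOfRecord₁₃Chi F N θ χ p) p.K k s.init U₀ *
          wOfRecord₉ F N θ.toStage9Params p (gOfRecord₁₃Chi F N θ χ p) k s U₀ ((avOfRecord F N p.K k).avg U₀)))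
    (hI : ∀ S ∈ admSOfRecord F θ.ν θ.τ9.M (gOfRecord₁₃Chi F N θ χ p) p.K k s.init,
      Integrable (fun U₀ : GaugeField (F.P p.K) k (SU N) => noExpIntegrandAt F N (FluctV N) p.K k W
        (tkBranchOfRecord F N (FluctV N) θ.ν θ.τ9.M _ p.K W s.init S k
          (fun ω => sect2Operand F N (FluctV N) p.K (settingOfRecord₁₃Chi F N θ χ p) Rz' s t' Ek' U' (S, fun j => (ω j).2) (fun j => (ω j).1)))
        ((avOfRecord F N p.K k).avg U₀) U₀) (fieldMeasure (F.P p.K) k (SU N))) :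
    slotsTOfRecord F N θ.ν θ.τ9 (EOfRecord₁₃Chi F N θ χ) (wOfRecord₉ F N θ.toStage9Params) θ.ppSel p (gOfRecord₁₃Chi F N θ χ p) (k + 1) s = 0 ∨
      ∀ᵐ V' ∂fieldMeasure (F.P p.K) (k + 1) (SU N),
        chiSeqOfRecord F N θ.ν θ.τ9.M (gOfRecord₁₃Chi F N θ χ p) p.K (k + 1) s V' ≠ 0 →
          slotsTOfRecord F N θ.ν θ.τ9 (EOfRecord₁₃Chi F N θ χ) (wOfRecord₉ F N θ.toStage9Params) θ.ppSel p
              (gOfRecord₁₃Chi F N θ χ p) (k + 1) s V' =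
            sect2Slot F N (FluctV N) p.K (settingOfRecord₁₃Chi F N θ χ p) Rz' W s t' Ek' U' V' := by
  rcases hid with h0 | hid
  · -- absent slot at `init s′` ⇒ absent pre-𝐑 slot at `s′`
    refine Or.inl ?_
    funext V'
    rw [slotsTOfRecord_succ_apply, h0]
    show transportOfRecord F N p.K k (fun U => _ * (_ * (0 : ℝ))) V' = 0
    simp only [mul_zero]
    show T4AveragingDisintegration.kernelTransport _ _ _ (fun _ => (0 : ℝ)) V' = 0
    simp only [T4AveragingDisintegration.kernelTransport, integral_zero, mul_zero]
  · exact hasSect2FormAtZ_clause_succ_of_zetaSpecChiAt_of_graph θ χ p hk s hΩ W Rz t Ek U hid Rz' t' Ek' U' hcκ hbranch hζχ hI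

end Positive

/-! ## §2  R4a′ — one weight family ∕ two families agreeing below `k` -/

section GenericW

variable (θ : Stage13Params F N) (χ : ChiSlot F N) (p : B12.RunParams)

/-- **★★ THE NO-EXPANSION 𝐓-STEP AFTER AN ARBITRARY HISTORY, CLAUSE-KEYED, ONE WEIGHT FAMILY.**  `s′` with `Ω_{k+1}(s′) = ∅` (`k < K`, `1 ≤ M`); the §2 dichotomy of
`ρ_k`'s slot at `init s′` for the witness `(t, E₀, U_k(init s′))` and residual `Rz` (`hid`); the weights `k`-local below `k` (`hζloc`, `hwloc`), the old action `k`-local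
in the fluctuation argument (`hA`); THE GENERATION-`k` PIN WITH THE OLD FRONT FACTOR on the averaging graph, `ζ_k(T)·w_k(∅,∅,∅)(U,Ū) = χ_k(init s′)(U)·w_k(s′)(U,Ū)`
(`hζχ`); displayed joint measurability ∕ bound of the new integrand per old branch.  Then the 𝐓-image dichotomy holds at `s′` for THE SAME `t`, `E₀`, the background
`U_{k+1}(s′)` and any residual `Rz′`. [cite: Balaban1988Convergent, Theorem p.245, (3.24)–(3.25) p.270, (2.18) p.257, (2.20)–(2.23) p.258, (3.16) p.268] -/
theorem clause_succ_of_Omega_empty_of_pinChi_of_clause_of_graph {k : ℕ} (hk : k < p.K) (hM : 1 ≤ θ.τ9.M)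
    (s : SeqOfRecord F θ.ν θ.τ9.M (gOfRecord₁₃Chi F N θ χ p) p.K (k + 1)) (hΩ : s.Ω (k + 1) = ∅) (W : TkWeights F N (FluctV N) p.K)
    (hζloc : ∀ j, j < k → ∀ ω ω' : MultiCfg (F.P p.K) (SU N) (FluctV N), (∀ i, i ≤ k → ω i = ω' i) →
      W.ζ j (s.init.Ω (j + 1))ᶜ ω = W.ζ j (s.init.Ω (j + 1))ᶜ ω')
    (hwloc : ∀ (S : ℕ → Set (Site (F.P p.K) 0)) (j : ℕ), j < k → ∀ ω ω' : MultiCfg (F.P p.K) (SU N) (FluctV N), (∀ i, i ≤ k → ω i = ω' i) →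
      W.w j (s.init.Λ (j + 1)) ((s.init.Λ (j + 1))ᶜ ∩ s.init.Ω (j + 1)) (S (j + 1)) ω =
        W.w j (s.init.Λ (j + 1)) ((s.init.Λ (j + 1))ᶜ ∩ s.init.Ω (j + 1)) (S (j + 1)) ω')
    (Rz Rz' : Sect2.Residual (F.P p.K) (MatA N)) (t : Sect2.TermValues (F.P p.K) (MatA N) (FluctV N) θ.τ9.M) (E₀ : ℝ)
    (hA : ∀ (S : ℕ → Set (Site (F.P p.K) 0)) (a a' : Tk.MSFluct (F.P p.K) (FluctV N)) (Uf : GaugeField (F.P p.K) 0 (SU N)), (∀ i, i ≤ k → a i = a' i) →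
      (sect2ActionDataOfRecord F N (FluctV N) p.K (settingOfRecord₁₃Chi F N θ χ p) Rz s.init t (S, a) E₀).action23 k Uf =
        (sect2ActionDataOfRecord F N (FluctV N) p.K (settingOfRecord₁₃Chi F N θ χ p) Rz s.init t (S, a') E₀).action23 k Uf)
    (hid : slotsOfRecord F N θ.ν θ.τ9 (EOfRecord₁₃Chi F N θ χ) (wOfRecord₉ F N θ.toStage9Params) θ.ppSel p (gOfRecord₁₃Chi F N θ χ p) k s.init = 0 ∨
      ∀ᵐ U₀ ∂fieldMeasure (F.P p.K) k (SU N),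
        chiSeqOfRecord F N θ.ν θ.τ9.M (gOfRecord₁₃Chi F N θ χ p) p.K k s.init U₀ ≠ 0 →
          slotsOfRecord F N θ.ν θ.τ9 (EOfRecord₁₃Chi F N θ χ) (wOfRecord₉ F N θ.toStage9Params) θ.ppSel p
              (gOfRecord₁₃Chi F N θ χ p) k s.init U₀ =
            sect2Slot F N (FluctV N) p.K (settingOfRecord₁₃Chi F N θ χ p) Rz W s.init t E₀ (UbgOfRecord₁₃CoPChi F N θ χ p k s.init) U₀)
    (hζχ : ∀ U₀ : GaugeField (F.P p.K) k (SU N),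
      W.ζ k Set.univ (pairCfgAt (V := FluctV N) k ((avOfRecord F N p.K k).avg U₀) U₀) *
          W.w k ∅ ∅ ∅ (pairCfgAt (V := FluctV N) k ((avOfRecord F N p.K k).avg U₀) U₀) =
        chiSeqOfRecord F N θ.ν θ.τ9.M (gOfRecord₁₃Chi F N θ χ p) p.K k s.init U₀ *
          wOfRecord₉ F N θ.toStage9Params p (gOfRecord₁₃Chi F N θ χ p) k s U₀ ((avOfRecord F N p.K k).avg U₀))
    (hI : ∀ S ∈ admSOfRecord F θ.ν θ.τ9.M (gOfRecord₁₃Chi F N θ χ p) p.K k s.init,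
      Integrable (fun U₀ : GaugeField (F.P p.K) k (SU N) => noExpIntegrandAt F N (FluctV N) p.K k W
        (tkBranchOfRecord F N (FluctV N) θ.ν θ.τ9.M _ p.K W s.init S k
          (fun ω => sect2Operand F N (FluctV N) p.K (settingOfRecord₁₃Chi F N θ χ p) Rz' s t E₀ (UbgOfRecord₁₃CoPChi F N θ χ p (k + 1) s)
            (S, fun j => (ω j).2) (fun j => (ω j).1)))
        ((avOfRecord F N p.K k).avg U₀) U₀) (fieldMeasure (F.P p.K) k (SU N))) :
    slotsTOfRecord F N θ.ν θ.τ9 (EOfRecord₁₃Chi F N θ χ) (wOfRecord₉ F N θ.toStage9Params) θ.ppSel p (gOfRecord₁₃Chi F N θ χ p) (k + 1) s = 0 ∨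
      ∀ᵐ V' ∂fieldMeasure (F.P p.K) (k + 1) (SU N),
        chiSeqOfRecord F N θ.ν θ.τ9.M (gOfRecord₁₃Chi F N θ χ p) p.K (k + 1) s V' ≠ 0 →
          slotsTOfRecord F N θ.ν θ.τ9 (EOfRecord₁₃Chi F N θ χ) (wOfRecord₉ F N θ.toStage9Params) θ.ppSel p
              (gOfRecord₁₃Chi F N θ χ p) (k + 1) s V' =
            sect2Slot F N (FluctV N) p.K (settingOfRecord₁₃Chi F N θ χ p) Rz' W s t E₀ (UbgOfRecord₁₃CoPChi F N θ χ p (k + 1) s) V' := by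
  refine clause_succ_of_zetaSpecChiAt_of_clause_of_graph θ χ p hk s hΩ W Rz t E₀ (UbgOfRecord₁₃CoPChi F N θ χ p k s.init) hid Rz' t E₀
    (UbgOfRecord₁₃CoPChi F N θ χ p (k + 1) s) (κ := 1) (c := 1) (one_mul 1) (fun S _ V' U₀ => ?_) (fun U₀ => by rw [hζχ U₀, one_mul]) hI
  rw [oldFactors_agree_of_Omega_empty θ χ p hM s hΩ W hζloc S (hwloc S) Rz Rz' t E₀ E₀ (hA S) V' U₀, sub_self, Real.exp_zero]

/-- **★★ THE GENERAL STEP ACROSS TWO WEIGHT FAMILIES AGREEING BELOW `k`.**  As §2, with the level-`k` dichotomy at `init s′` stated at the OLD weights `W₀` and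
everything at `s′` at the NEW weights `W`, under `∀ j < k, W.ζ j = W₀.ζ j ∧ W.w j = W₀.w j` — the (PC) bridge (p536516: a length-`k` slot reads the weights below
generation `k` only); director-ym №186 (2): at print's witness this agreement is the statement «the component is untouched by R^{(k+1)}».
[cite: Balaban1988Convergent, Theorem p.245, (3.24)–(3.25) p.270, (2.20)–(2.22) p.258; Balaban1989LargeFieldI, (0.2)–(0.3) p.176] -/
theorem clause_succ_of_Omega_empty_of_prefix_of_clause_of_graph {k : ℕ} (hk : k < p.K) (hM : 1 ≤ θ.τ9.M)
    (s : SeqOfRecord F θ.ν θ.τ9.M (gOfRecord₁₃Chi F N θ χ p) p.K (k + 1)) (hΩ : s.Ω (k + 1) = ∅) (W W₀ : TkWeights F N (FluctV N) p.K)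
    (hpre : ∀ j, j < k → W.ζ j = W₀.ζ j ∧ W.w j = W₀.w j)
    (hζloc : ∀ j, j < k → ∀ ω ω' : MultiCfg (F.P p.K) (SU N) (FluctV N), (∀ i, i ≤ k → ω i = ω' i) →
      W.ζ j (s.init.Ω (j + 1))ᶜ ω = W.ζ j (s.init.Ω (j + 1))ᶜ ω')
    (hwloc : ∀ (S : ℕ → Set (Site (F.P p.K) 0)) (j : ℕ), j < k → ∀ ω ω' : MultiCfg (F.P p.K) (SU N) (FluctV N), (∀ i, i ≤ k → ω i = ω' i) →
      W.w j (s.init.Λ (j + 1)) ((s.init.Λ (j + 1))ᶜ ∩ s.init.Ω (j + 1)) (S (j + 1)) ω =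
        W.w j (s.init.Λ (j + 1)) ((s.init.Λ (j + 1))ᶜ ∩ s.init.Ω (j + 1)) (S (j + 1)) ω')
    (Rz Rz' : Sect2.Residual (F.P p.K) (MatA N)) (t : Sect2.TermValues (F.P p.K) (MatA N) (FluctV N) θ.τ9.M) (E₀ : ℝ)
    (hA : ∀ (S : ℕ → Set (Site (F.P p.K) 0)) (a a' : Tk.MSFluct (F.P p.K) (FluctV N)) (Uf : GaugeField (F.P p.K) 0 (SU N)), (∀ i, i ≤ k → a i = a' i) →
      (sect2ActionDataOfRecord F N (FluctV N) p.K (settingOfRecord₁₃Chi F N θ χ p) Rz s.init t (S, a) E₀).action23 k Uf =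
        (sect2ActionDataOfRecord F N (FluctV N) p.K (settingOfRecord₁₃Chi F N θ χ p) Rz s.init t (S, a') E₀).action23 k Uf)
    (hid : slotsOfRecord F N θ.ν θ.τ9 (EOfRecord₁₃Chi F N θ χ) (wOfRecord₉ F N θ.toStage9Params) θ.ppSel p (gOfRecord₁₃Chi F N θ χ p) k s.init = 0 ∨
      ∀ᵐ U₀ ∂fieldMeasure (F.P p.K) k (SU N),
        chiSeqOfRecord F N θ.ν θ.τ9.M (gOfRecord₁₃Chi F N θ χ p) p.K k s.init U₀ ≠ 0 →
          slotsOfRecord F N θ.ν θ.τ9 (EOfRecord₁₃Chi F N θ χ) (wOfRecord₉ F N θ.toStage9Params) θ.ppSel p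
              (gOfRecord₁₃Chi F N θ χ p) k s.init U₀ =
            sect2Slot F N (FluctV N) p.K (settingOfRecord₁₃Chi F N θ χ p) Rz W₀ s.init t E₀ (UbgOfRecord₁₃CoPChi F N θ χ p k s.init) U₀)
    (hζχ : ∀ U₀ : GaugeField (F.P p.K) k (SU N),
      W.ζ k Set.univ (pairCfgAt (V := FluctV N) k ((avOfRecord F N p.K k).avg U₀) U₀) *
          W.w k ∅ ∅ ∅ (pairCfgAt (V := FluctV N) k ((avOfRecord F N p.K k).avg U₀) U₀) =
        chiSeqOfRecord F N θ.ν θ.τ9.M (gOfRecord₁₃Chi F N θ χ p) p.K k s.init U₀ *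
          wOfRecord₉ F N θ.toStage9Params p (gOfRecord₁₃Chi F N θ χ p) k s U₀ ((avOfRecord F N p.K k).avg U₀))
    (hI : ∀ S ∈ admSOfRecord F θ.ν θ.τ9.M (gOfRecord₁₃Chi F N θ χ p) p.K k s.init,
      Integrable (fun U₀ : GaugeField (F.P p.K) k (SU N) => noExpIntegrandAt F N (FluctV N) p.K k W
        (tkBranchOfRecord F N (FluctV N) θ.ν θ.τ9.M _ p.K W s.init S k
          (fun ω => sect2Operand F N (FluctV N) p.K (settingOfRecord₁₃Chi F N θ χ p) Rz' s t E₀ (UbgOfRecord₁₃CoPChi F N θ χ p (k + 1) s)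
            (S, fun j => (ω j).2) (fun j => (ω j).1)))
        ((avOfRecord F N p.K k).avg U₀) U₀) (fieldMeasure (F.P p.K) k (SU N))) :
    slotsTOfRecord F N θ.ν θ.τ9 (EOfRecord₁₃Chi F N θ χ) (wOfRecord₉ F N θ.toStage9Params) θ.ppSel p (gOfRecord₁₃Chi F N θ χ p) (k + 1) s = 0 ∨
      ∀ᵐ V' ∂fieldMeasure (F.P p.K) (k + 1) (SU N),
        chiSeqOfRecord F N θ.ν θ.τ9.M (gOfRecord₁₃Chi F N θ χ p) p.K (k + 1) s V' ≠ 0 →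
          slotsTOfRecord F N θ.ν θ.τ9 (EOfRecord₁₃Chi F N θ χ) (wOfRecord₉ F N θ.toStage9Params) θ.ppSel p
              (gOfRecord₁₃Chi F N θ χ p) (k + 1) s V' =
            sect2Slot F N (FluctV N) p.K (settingOfRecord₁₃Chi F N θ χ p) Rz' W s t E₀ (UbgOfRecord₁₃CoPChi F N θ χ p (k + 1) s) V' := by
  have hsl : sect2Slot F N (FluctV N) p.K (settingOfRecord₁₃Chi F N θ χ p) Rz W₀ s.init t E₀ (UbgOfRecord₁₃CoPChi F N θ χ p k s.init) =
      sect2Slot F N (FluctV N) p.K (settingOfRecord₁₃Chi F N θ χ p) Rz W s.init t E₀ (UbgOfRecord₁₃CoPChi F N θ χ p k s.init) :=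
    (sect2Slot_congr_of_weights θ.ν θ.τ9.M (gOfRecord₁₃Chi F N θ χ p) p.K _ Rz W W₀ s.init t E₀ _ (fun j hj => (hpre j hj).1) (fun j hj => (hpre j hj).2)).symm
  simp only [hsl] at hid
  exact clause_succ_of_Omega_empty_of_pinChi_of_clause_of_graph θ χ p hk hM s hΩ W hζloc hwloc Rz Rz' t E₀ hA hid hζχ hI

end GenericW

end Summit.QuantumFields.YangMills.Theorems.BalabanUVNodesN11NoExpansionGeneralStepGraphChi

end
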